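import Literature.MathematicalPhysics.QuantumFieldTheory.Balaban1983to89.Node00.SmallFieldChi29SelOfRecord
import Summits.QuantumFields.YangMills.Theorems.BalabanUVNodesN11TkOpMeasurable

/-!
# NODE N09 [B12] — BOREL MEASURABILITY OF THE CANONICAL-VERSION TRANSPORT `TcanOfRecord` AND OF THE β-LAYER OVER IT: the road-B binder `hρm : Measurable ρ_k` for the
# (0.19) β-inputs `ρ_k = χ_k·exp[−GF_k∕g_k² + A_k]` over `TcanOfRecord` is a THEOREM for every measurable χ family — unconditionally for the offer `chiFixed29Sel`

Cell `pub-ymgap` (YM-PLAN Track A), width seat `pub-ymgap-dag-n09-w3` g6 (node N09 [Balaban1987RG1]), FILE 6; count-neutral helper keyed to K1⁹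
`StabilityBRunRowsAtRecordR13SepCoPHV` = stmt-QuantumFields-27364 (`--kind proof --supports … --as helper`).  Over node00-def-K0e's `Node00/CanonicalTransportOfRecord` ∕
`Node00/BetaInputIntegrable`, K0c∕dag-n09-w4 g2's `Node00/SmallFieldChi29SelOfRecord` and the N11 lane's `…N11TkOpMeasurable.measurable_kernelTransport` — all BY NAME.

WHY.  This seat's g5∕g6 road-B doors (`…N09RegularOfLoopSmallChi29.regular_of_loopSmall_chi29`, `…N09RegularOnOfLoopSmallChi29Local.regularOn_of_loopSmall_chi29_local`, their
selection-generic editions) — like dag-n09-w2's engine behind them — ask BOREL measurability `hρm : Measurable ρ` of the density.  For the record's β-inputs over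
`TβOfRecord₁₃ = TcanOfRecord` the tree has only INTEGRABILITY (K0e `integrable_betaInput_TcanOfRecord`, hence a.e.-strong measurability): the recursion `A_{k+1} =
log(𝐍_k⁻¹·T_kρ_k)` reads `TcanOfRecord`, a `canonVersion` — an `if`-glued object whose continuous branch is a `Classical.choose` known only to be continuous ON the
maximal regular set.  THIS FILE proves that `TcanOfRecord ρ` IS Borel measurable for measurable `ρ` (the kernel transform is measurable — marginal density × a Markov-kernel
integral —, and a function that is a continuous `g` on an OPEN set `s` and a measurable `f` off it is measurable even though `g` is arbitrary off `s`), hence by induction on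
the level every β-input over `TcanOfRecord` with a measurable χ family is measurable: `hρm` for the offer `chiFixed29Sel` with NO hypothesis, for the bare `chiFixed29`
under (H-U).

WHAT IS PROVED (theorems only; 0 def, 0 sorry; axioms standard).
§1 generic: `measurable_piecewise_of_continuousOn_of_isOpen`, `measurable_contVersionOn`, `measurable_canonVersion`.
§2 `measurable_transportOfRecord` (the N11 lane's `measurable_kernelTransport`), ★★ `measurable_TcanOfRecord`.
§3 ★★ `measurable_effActionHT_TcanOfRecord` ∕ ★★★ `measurable_betaInput_TcanOfRecord` (every level, every measurable χ family), ★★ `measurable_betaInput_TcanOfRecord_chi29Sel`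
   (NO hypothesis), `measurable_betaInput_TcanOfRecord_chi29_of` (bare χ under (H-U) `Measurable (Uk …)`).

HONEST FRAMING.  Kernel measure theory BY NAME (Mathlib `measurable_of_isOpen`; the N11 lane's kernel-integral measurability; the tree's `isOpen_regSet`,
`measurable_integrand`, `measurable_gfOfRecord`, K0c's `measurable_chiFixed29Sel`); NOTHING of Bałaban's asserted; no estimate; NO record edition; (H-U) stays displayed for the
bare choice; N09 NOT discharged; K0⁷ ∕ K1⁹ ∕ K2⁹ ∕ K3⁸ NOT closed; counts unmoved (typed 28∕28 · discharged 5∕28); one finite four-torus programme at fixed `ε = L^{−K}` — R4 is the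
conditional rung `BalabanLadder.UV` only; NOT continuum ∕ ℝ⁴ ∕ OS; the Yang–Mills mass gap (Clay) is NOT proved by any of this.  No `instance`, no `notation`.
-/

noncomputable section

open MeasureTheory ProbabilityTheory Set

namespace Summit.QuantumFields.YangMills.BalabanUVNodes.N09BetaInputMeasurableOverTcan

open Literature.MathematicalPhysics.QuantumFieldTheory.Balaban1983to89
open Literature.MathematicalPhysics.QuantumFieldTheory.Balaban1983to89.Node00

open _root_.Topology
open Literature.MathematicalPhysics.QuantumFieldTheory.Balaban1983to89.T4Continuum (T4Family)
open Literature.MathematicalPhysics.QuantumFieldTheory.Balaban1983to89.B12Eq019ActionBody (integrand nextAction normConst)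
open Literature.MathematicalPhysics.QuantumFieldTheory.Balaban1983to89.B12NodeKnitContinuousTransport (measurable_gfOfRecord measurable_integrand)
open Summit.QuantumFields.YangMills.Theorems.BalabanUVNodesN11TkOpMeasurable (measurable_kernelTransport)

/-! ## §1. A function continuous on an open set and measurable off it is measurable -/

section Generic

variable {α : Type*} [TopologicalSpace α] [MeasurableSpace α] [OpensMeasurableSpace α]

/-- **PIECEWISE MEASURABILITY WITH A MERELY `ContinuousOn` BRANCH**: for an OPEN `s`, `g` continuous ON `s` (arbitrary off it) and `f` measurable, `s.piecewise g f` is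
measurable — the preimage of an open `O` is `(s ∩ g⁻¹O) ∪ (sᶜ ∩ f⁻¹O)`, the first part open (`ContinuousOn.isOpen_inter_preimage`). [cite: Balaban1987RG1, (0.13) p.254 (bookkeeping)] -/
theorem measurable_piecewise_of_continuousOn_of_isOpen {s : Set α} (hs : IsOpen s) {f g : α → ℝ} (hg : ContinuousOn g s) (hf : Measurable f)
    [DecidablePred (· ∈ s)] : Measurable (s.piecewise g f) := by
  refine measurable_of_isOpen fun O hO => ?_
  have h1 : s.piecewise g f ⁻¹' O = (s ∩ g ⁻¹' O) ∪ (sᶜ ∩ f ⁻¹' O) := by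
    ext x; by_cases hx : x ∈ s <;> simp [Set.piecewise, hx]
  rw [h1]
  exact (hg.isOpen_inter_preimage hs hO).measurableSet.union (hs.measurableSet.compl.inter (hf hO.measurableSet))

/-- **node00-def-T∕K0e's ON-DOMAIN VERSION IS MEASURABLE** on an OPEN domain, for measurable `f` (its continuous branch is used on `s` only). [cite: Balaban1987RG1, (0.13) p.254 (bookkeeping)] -/
theorem measurable_contVersionOn {μ : Measure α} {f : α → ℝ} {s : Set α} (hs : IsOpen s) (hf : Measurable f) : Measurable (contVersionOn μ f s) := by
  classical
  unfold contVersionOn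
  split_ifs with h
  · have e : (fun x => if x ∈ s then h.choose x else f x) = s.piecewise h.choose f := by
      funext x; simp only [Set.piecewise]
    rw [e]
    exact measurable_piecewise_of_continuousOn_of_isOpen hs h.choose_spec.1 hf
  · exact hf

/-- **K0e's CANONICAL VERSION IS MEASURABLE** for measurable `f` (the maximal regular set is open, `isOpen_regSet`). [cite: Balaban1987RG1, (0.13) p.254 (bookkeeping)] -/
theorem measurable_canonVersion {μ : Measure α} {f : α → ℝ} (hf : Measurable f) : Measurable (canonVersion μ f) :=
  measurable_contVersionOn isOpen_regSet hf

end Generic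

/-! ## §2. The kernel transform and the canonical-version transport of record are measurable -/

section Transport

variable {F : T4Family} {N : ℕ} [NeZero N]

/-- **THE TRANSFORM OF RECORD OF A MEASURABLE DENSITY IS MEASURABLE.** [cite: Balaban1988Convergent, (3.1) p.264 (bookkeeping)] -/
theorem measurable_transportOfRecord (K k : ℕ) {ρ : Density (F.P K) k (SU N)} (hρ : Measurable ρ) : Measurable (transportOfRecord F N K k ρ) :=
  measurable_kernelTransport (fieldMeasure (F.P K) k (SU N)) (fieldMeasure (F.P K) (k + 1) (SU N)) (avOfRecord F N K k).avg hρ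

/-- ★★ **`TcanOfRecord F N K k ρ` IS BOREL MEASURABLE for measurable `ρ`** (canonical version of a measurable function, §1). [cite: Balaban1987RG1, (0.13) p.254 and (0.19) p.255 (bookkeeping)] -/
theorem measurable_TcanOfRecord (K k : ℕ) {ρ : Density (F.P K) k (SU N)} (hρ : Measurable ρ) : Measurable (TcanOfRecord F N K k ρ) := by
  have h : Measurable (canonVersion (α := PBond (F.P K) (k + 1) → SU N) (piHaar (F.P K) (k + 1) (SU N))
      (fun V : PBond (F.P K) (k + 1) → SU N => transportOfRecord F N K k ρ V)) :=
    measurable_canonVersion (α := PBond (F.P K) (k + 1) → SU N) (measurable_transportOfRecord K k hρ)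
  exact h

end Transport

/-! ## §3. The β-layer over `TcanOfRecord` is measurable, level by level -/

section Beta

variable {F : T4Family} {N : ℕ} [NeZero N]

/-- ★★★ **EVERY (0.19) β-INPUT OVER `TcanOfRecord` WITH A MEASURABLE χ FAMILY IS BOREL MEASURABLE, AND SO IS EVERY `A_k`** — induction on the level: `A_0 = −(1∕g_0²)·(Wilson)`;
`A_{k+1} = log(𝐍_k⁻¹ · TcanOfRecord ρ_k)` with `ρ_k = χ_k·exp[−GF_k∕g_k² + A_k]` measurable by the hypothesis at `k` (`measurable_integrand`, `measurable_gfOfRecord`) and §2.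
[cite: Balaban1987RG1, (0.17)–(0.19) p.255] -/
theorem measurable_effActionHT_TcanOfRecord (χ : (K : ℕ) → (ℕ → ℝ) → (k : ℕ) → Density (F.P K) k (SU N)) (K : ℕ) (g : ℕ → ℝ)
    (hχm : ∀ k, Measurable (χ K g k)) : ∀ k, Measurable (effActionHT F N (TcanOfRecord F N) χ K g k)
  | 0 => by
    rw [effActionHT_zero]
    exact T4WilsonResponseJunction.measurable_neg_mul_wilsonAction _ _
  | k + 1 => by
    have hA := measurable_effActionHT_TcanOfRecord χ K g hχm k
    have hρ : Measurable (integrand (χ K g k) (gfOfRecord F N K k) (g k) (effActionHT F N (TcanOfRecord F N) χ K g k)) :=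
      measurable_integrand (hχm k) (measurable_gfOfRecord K k) hA (g k)
    rw [effActionHT_succ]
    show Measurable fun V => Real.log ((normConst (TcanOfRecord F N K k) (χ K g k) (gfOfRecord F N K k) (g k)
      (effActionHT F N (TcanOfRecord F N) χ K g k))⁻¹ * TcanOfRecord F N K k (integrand (χ K g k) (gfOfRecord F N K k) (g k)
        (effActionHT F N (TcanOfRecord F N) χ K g k)) V)
    exact Real.measurable_log.comp ((measurable_TcanOfRecord K k hρ).const_mul _)

/-- ★★★ **… hence every β-input `betaInputOfRecord (TcanOfRecord) χ K g k` is Borel measurable** (road B's binder `hρm` over the canonical-version transport).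
[cite: Balaban1987RG1, (0.19) p.255] -/
theorem measurable_betaInput_TcanOfRecord (χ : (K : ℕ) → (ℕ → ℝ) → (k : ℕ) → Density (F.P K) k (SU N)) (K : ℕ) (g : ℕ → ℝ)
    (hχm : ∀ k, Measurable (χ K g k)) (k : ℕ) : Measurable (betaInputOfRecord F N (TcanOfRecord F N) χ K g k) :=
  measurable_integrand (hχm k) (measurable_gfOfRecord K k) (measurable_effActionHT_TcanOfRecord χ K g hχm k) (g k)

/-- ★★ **FOR THE OFFER `chiFixed29Sel` — NO HYPOTHESIS** (K0c's `measurable_chiFixed29Sel`): the Sel β-inputs over `TcanOfRecord` are Borel measurable at every level.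
[cite: Balaban1987RG1, (0.19) p.255 and (2.9) p.266] -/
theorem measurable_betaInput_TcanOfRecord_chi29Sel (ν : Stage7Numerics) (ε₁ : ℝ) (K : ℕ) (g : ℕ → ℝ) (k : ℕ) :
    Measurable (betaInputOfRecord F N (TcanOfRecord F N) (chiFixed29Sel F N ν ε₁) K g k) :=
  measurable_betaInput_TcanOfRecord _ K g (fun k => measurable_chiFixed29Sel ν ε₁ K g k) k

/-- **FOR THE BARE χ `chiFixed29` UNDER (H-U)** (K0e's `measurable_chiFix29OfRecord_of`): the record's β-inputs over `TcanOfRecord` are Borel measurable given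
`Measurable (Uk F N K (k+1) ν.εreg)` at every level. [cite: Balaban1987RG1, (0.19) p.255 and (2.9) p.266] -/
theorem measurable_betaInput_TcanOfRecord_chi29_of (ν : Stage7Numerics) (ε₁ : ℝ) (K : ℕ) (g : ℕ → ℝ)
    (hU : ∀ k, Measurable (Uk F N K (k + 1) ν.εreg)) (k : ℕ) :
    Measurable (betaInputOfRecord F N (TcanOfRecord F N) (chiFixed29 F N ν ε₁) K g k) :=
  measurable_betaInput_TcanOfRecord _ K g (fun k => measurable_chiFix29OfRecord_of ε₁ (hU k)) k

end Beta

end Summit.QuantumFields.YangMills.BalabanUVNodes.N09BetaInputMeasurableOverTcan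

end
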